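import Summits.QuantumFields.YangMills.Theorems.UnitScaleTiltProp7SymFrameRelCluster
import Summits.QuantumFields.YangMills.Theorems.UnitScaleTiltProp7SymFrameOneStep
import Summits.QuantumFields.YangMills.Theorems.UnitScaleTiltProp7SymAvgTwSymDefs
import Summits.QuantumFields.YangMills.Theorems.UnitScaleTiltProp7DbarTwWindow
import HarnessLib

/-!
# `UnitScaleTiltProp7DbarTwSymWindow` — W3 PART 2∕2 OF THE (47)-twˢ PLAN (OWNER RULINGS g26-№12 (3d)∕№13 (iii)): **(WIN-twˢ) — THE `log` WINDOW OF THE RE-BASED TWISTED AVERAGE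
# `dbarTwS` (SYMMETRIC, CENTRE-ANCHORED COVARIANT FRAMES) AT A PRINTED-REGULAR BACKGROUND, DISCHARGED FROM `RegPr`** — the symmetric-frame twin of ✓p609764: for `U₀ ∈ 𝔘_k(ε₀)` and a
# bondwise exponent of (19)-size `< e`, `‖U̿^{twS}(iX)(c) − 1‖ ≤ 3(2e + 2700Lε₀) ≤ ½ < 1` at every comparison bond under the L-only numerals `10⁹L²e ≤ 1`, `10¹²L³ε₀ ≤ 1` (NO (WΣ) tower
# windows); plus the accumulated symmetric frames at the ends of `c` within `30L(2e + 2700Lε₀)` of `1` (the radius row of ★w3-20520 g4's W4)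
# (route `UnitScaleTilt`, crux K1 «MinimiserStabilityRegPr» stmt-QuantumFields-19200, stub `stub_existenceMinimalOrbit` (EX), route (α), node (AVG-SYM); def-free, count-neutral)

Cell `ym3-torus` (HUMAN RULING D-0037, YM ladder rung R3 — YM₃ on T³ is a rung, not d = 4, not a mass gap, not Clay), width seat `ym-ust-20520-w4` (gen 3).

THE PRINT.  [Balaban1985Averaging] (89)–(92) p. 31, (161)–(163) p. 42, p. 44; [Balaban1985RegularSpaces] (1.31) p. 82 (the logarithm is taken inside `|· − 1| < 1`), Prop. 7 p. 100;
[Balaban1985Variational] (2) p. 278, (19) p. 281, (44) p. 285.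

WHAT IS PROVED (sorry-free, no definition; `M₂ = Matrix (Fin 2) (Fin 2) ℂ`, `L²`-operator norm; `ℓ = 5L` at `d = 3`):
* §2 (T³, rows displayed) `budget_T3_frames` (`Lᵏ(2t + 30ℓs_B) ≤ 2e + 2700Lε₀`, `6400ℓ²Lᵏs_B ≤ 1` from `10⁷L³ε₀ ≤ 1`), ★★`norm_dbarTwS_sub_one_le_of_regPr` (frame window (WF)
  `8(16C₁+2)(5L)²(2e + 2700Lε₀) ≤ 1` displayed): `‖U̿^{twS}(A)(c) − 1‖ ≤ 3(2e + 2700Lε₀)`, frames `≤ 30L(2e + 2700Lε₀)` — part 1 ∘ ★w5-20520 g3's (92) ✓`dbarTwS_eq_dbarCovIterU_mul_inv`.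
* §3 ROWS DISCHARGED by ★w4-19200 g3's W1 (✓`norm_dbarCovU_mul_inv_sub_one_le`, `C₁ = 22100`; ✓`norm_vframeCovU_sub_one_le_of_diff`): `hstep_T3`, `hframe_T3`, `windows_of_numerals`,
  ★★`norm_dbarTwS_sub_one_le`, ★★★**`dbarTwS_window_of_regPr`** (`≤ ½ ∧ < 1` at `A := iX`, `nMax19 U₀ X < e`; the Hermitian-traceless hypothesis of the knit's binder is not needed).
HONEST FRAMING.  Bookkeeping over W0∕W1∕W2∕part 1 and ✓p615607's definitions; the numerals are this lineage's crude ones (stronger than (W137) by ≈ 10² on `ε₀`, an L-only smallness absorbed by the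
stub's `a₁′(L, B₃)`); nothing of print is asserted; the stub EX, the crux and the gap are NOT claimed.  `--supports stmt-QuantumFields-19200 --as helper`.

References: T. Bałaban, CMP 98 (1985) 17–51 [Balaban1985Averaging] ((82) p.30, (89)–(92) p.31, (97) p.32, (123)–(125) p.36, (161)–(163) p.42, p.44); CMP 99 (1985) 75–102
[Balaban1985RegularSpaces] ((1.31) p.82, Prop. 7 p.100); CMP 102 (1985) 277–309 [Balaban1985Variational] ((2) p.278, (6) p.278, (19) p.281, (44) p.285).
-/

set_option autoImplicit false

noncomputable section

open scoped BigOperators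

namespace Summit.QuantumFields.YangMills.Theorems.Prop7DbarTwSymWindow

/-! ## §2 At the T³ letters: the window of the re-based twisted average `dbarTwS` at a printed-regular background -/

section T3

open scoped Matrix.Norms.L2Operator
open Literature.MathematicalPhysics.QuantumFieldTheory.Balaban1983to89
open Literature.MathematicalPhysics.QuantumFieldTheory.Balaban1983to89.T3ContinuumYM3Torus
open T3RegularMinimiser (regThreshold)
open T3PrintedRegularMinimiser (RegPr)
open T3SectALandauChart (eta eta_pos bgUnits)
open T3LevelShift (siteShift bondShift bondShift_src bondShift_tgt)
open T3PrintedRegularOrbits (sites_eq)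
open B7Prop1Explicit (expUnit)
open B10Eq27TorusAxialLog (unitsField toUField)
open Summit.QuantumFields.YangMills.Theorems.Prop8Chart (expCfg emlAvgU emlIterU)
open Summit.QuantumFields.YangMills.Theorems.Prop7TPrint (nMax19 nMax19_lt_iff)
open Summit.QuantumFields.YangMills.Theorems.Prop7SymAvgGLSmallOfRegPr (bgUnits_eq)
open Summit.QuantumFields.YangMills.Theorems.Prop7SymAvgRelativeBound (perturbedField_eq budget_T3)
open Summit.QuantumFields.YangMills.Theorems.Prop7SymAvgTwSym (vframeCovU dbarCovU dbarCovIterU frameAccU frameTwS dbarTwS frameTwS_def dbarTwS_eq_dbarCovIterU_mul_inv)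
open Summit.QuantumFields.YangMills.Theorems.Prop7DbarTwWindow (norm_smul_eta_inv_le norm_smul_I_le_of_nMax19_lt)
open Summit.QuantumFields.YangMills.Theorems.Prop7SymFrameRelCluster (norm_dbarCovIterU_rel_frameAccU_le_of_plaqSmall)

variable (F : T3Family) {n K : ℕ} (h : n ≤ K)

/-- **T³ BOOKKEEPING FOR THE CLUSTER BUDGETS**: with `k = K − n`, `η = L^{−k}`, `a₀ = ε₀L^{−2k}` (`regThreshold`), `s_B = 2·3·(3Lᵏ − 1)a₀`, `t = ηe`: `Lᵏ·(2t + 30ℓs_B) ≤ 2e + 2700Lε₀`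
(`Lᵏη = 1`, `Lᵏs_B ≤ 18ε₀`, `ℓ = 5L`), and `6400ℓ²Lᵏs_B ≤ 1` under `10⁷L³ε₀ ≤ 1`. [cite: Balaban1985Variational, (2) p.278, (6) p.278] -/
theorem budget_T3_frames {ε₀ : ℝ} (e : ℝ) (hε₀ : 0 < ε₀) (hε : 10 ^ 7 * (F.L : ℝ) ^ 3 * ε₀ ≤ 1) :
    0 ≤ 2 * (((F.P K).d : ℝ) * (3 * ((F.P K).L : ℝ) ^ (K - n) - 1)) * regThreshold F n K ε₀ ∧
    ((F.P K).L : ℝ) ^ (K - n) * (2 * ((((F.L : ℝ)⁻¹) ^ (K - n)) * e) +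
        30 * ((((F.P K).d + 2) * (F.P K).L : ℕ) : ℝ) * (2 * (((F.P K).d : ℝ) * (3 * ((F.P K).L : ℝ) ^ (K - n) - 1)) * regThreshold F n K ε₀))
      ≤ 2 * e + 2700 * (F.L : ℝ) * ε₀ ∧
    6400 * ((((F.P K).d + 2) * (F.P K).L : ℕ) : ℝ) ^ 2 * ((F.P K).L : ℝ) ^ (K - n) * (2 * (((F.P K).d : ℝ) * (3 * ((F.P K).L : ℝ) ^ (K - n) - 1)) * regThreshold F n K ε₀) ≤ 1 := by
  have hd : (F.P K).d = 3 := T3Family.P_d F K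
  have hLL : ((F.P K).L : ℝ) = F.L := rfl
  have hL3 : 3 ≤ F.L := by obtain ⟨a, ha⟩ := F.hL.1; have := F.hL.2; omega
  have hL3r : (3 : ℝ) ≤ F.L := by exact_mod_cast hL3
  have hL0 : (0 : ℝ) < F.L := by linarith
  have hL1 : (1 : ℝ) ≤ F.L := by linarith
  have hℓ : ((((F.P K).d + 2) * (F.P K).L : ℕ) : ℝ) = 5 * (F.L : ℝ) := by
    rw [hd, ← hLL]; push_cast; ring
  rw [hℓ, hd, hLL]
  push_cast
  set k := K - n with hk
  set X : ℝ := (F.L : ℝ) ^ k with hX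
  have hX1 : 1 ≤ X := one_le_pow₀ hL1
  have hX0 : 0 < X := by positivity
  set η : ℝ := ((F.L : ℝ)⁻¹) ^ k with hη
  have hXη : X * η = 1 := by rw [hX, hη, inv_pow, mul_inv_cancel₀ (pow_ne_zero _ hL0.ne')]
  set a₀ : ℝ := regThreshold F n K ε₀ with ha₀
  have ha₀0 : 0 < a₀ := by rw [ha₀]; unfold regThreshold; positivity
  have hXa : X * (X * a₀) = ε₀ := by
    have hX2 : X * X = (F.L : ℝ) ^ (2 * k) := by rw [hX, ← pow_add, two_mul]
    have ha : a₀ = ε₀ * ((F.L : ℝ) ^ (2 * k))⁻¹ := by rw [ha₀]; unfold regThreshold; rw [hk, inv_pow]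
    rw [← mul_assoc, hX2, ha, mul_comm ε₀, ← mul_assoc, mul_inv_cancel₀ (pow_ne_zero _ hL0.ne'), one_mul]
  have h3X : (0 : ℝ) ≤ 3 * X - 1 := by linarith
  have hsB0 : 0 ≤ 2 * (3 * (3 * X - 1)) * a₀ := by positivity
  -- `X·s_B = 18ε₀ − 6Xa₀ ≤ 18ε₀`
  have hXsB : X * (2 * (3 * (3 * X - 1)) * a₀) ≤ 18 * ε₀ := by
    have e1 : X * (2 * (3 * (3 * X - 1)) * a₀) = 18 * (X * (X * a₀)) - 6 * (X * a₀) := by ring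
    rw [e1, hXa]; linarith [mul_nonneg hX0.le ha₀0.le]
  refine ⟨hsB0, ?_, ?_⟩
  · have e1 : X * (2 * (η * e) + 30 * (5 * (F.L : ℝ)) * (2 * (3 * (3 * X - 1)) * a₀)) = 2 * (X * η) * e + 150 * (F.L : ℝ) * (X * (2 * (3 * (3 * X - 1)) * a₀)) := by ring
    rw [e1, hXη]
    nlinarith [mul_le_mul_of_nonneg_left hXsB (by positivity : (0 : ℝ) ≤ 150 * (F.L : ℝ))]
  · -- `6400·25L²·X·s_B ≤ 160000L²·18ε₀ ≤ 2.88·10⁶·L³ε₀ ≤ 1`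
    have e1 : 6400 * (5 * (F.L : ℝ)) ^ 2 * X * (2 * (3 * (3 * X - 1)) * a₀) = 160000 * (F.L : ℝ) ^ 2 * (X * (2 * (3 * (3 * X - 1)) * a₀)) := by ring
    rw [e1]
    have h1 : (F.L : ℝ) ^ 2 * ε₀ ≤ (F.L : ℝ) ^ 3 * ε₀ := mul_le_mul_of_nonneg_right (pow_le_pow_right₀ hL1 (by norm_num)) hε₀.le
    nlinarith [mul_le_mul_of_nonneg_left hXsB (by positivity : (0 : ℝ) ≤ 160000 * (F.L : ℝ) ^ 2)]

/-- ★★ **THE RE-BASED TWISTED AVERAGE AT A PRINTED-REGULAR BACKGROUND, QUANTITATIVE**: for `U₀ ∈ 𝔘_k(ε₀)` (`RegPr F n K ε₀ U₀`), every COMPLEX bondwise `A` with `‖A(b)‖ ≤ e·η`, under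
`10⁷L³ε₀ ≤ 1`, `10⁶L²e ≤ 1` and the FRAME WINDOW (WF) `8(16C₁+2)·(5L)²·(2e + 2700Lε₀) ≤ 1` (`C₁` = the covariant one-step constant of W1): at every comparison bond `c`,
`‖U̿^{twS}(A)(c) − 1‖ ≤ 3(2e + 2700Lε₀)` — §1 at `P := F.P K`, `k := K − n`, `η := L^{−(K−n)}`, `A″ := (iη)⁻¹A` (`perturbedField_eq`), through ★w5-20520 g3's (92)
`dbarTwS_eq_dbarCovIterU_mul_inv`. [cite: Balaban1985Averaging, (92) p.31, (161)–(163) p.42, p.44; Balaban1985RegularSpaces, (1.31) p.82; Balaban1985Variational, (2) p.278, (19) p.281, (44) p.285] -/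
theorem norm_dbarTwS_sub_one_le_of_regPr {C₁ : ℝ} (hC₁ : 2 ≤ C₁)
    (hstep : ∀ (j : ℕ), j + 1 ≤ (F.P K).m + (F.P K).K → ∀ (U₀ W : GaugeField (F.P K) j (Matrix (Fin 2) (Fin 2) ℂ)ˣ) (c : PBond (F.P K) (j + 1)) (s₀ s₁ δ : ℝ),
      0 ≤ s₀ → 0 ≤ s₁ → 0 ≤ δ → 120 * ((((F.P K).d + 2) * (F.P K).L : ℕ) : ℝ) * (s₀ + s₁) ≤ 1 →
      (∀ b : PBond (F.P K) j, (blockOf b.src = c.src ∨ blockOf b.src = c.tgt) → (blockOf b.tgt = c.src ∨ blockOf b.tgt = c.tgt) →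
        ‖((U₀ b : (Matrix (Fin 2) (Fin 2) ℂ)ˣ) : Matrix (Fin 2) (Fin 2) ℂ) - 1‖ ≤ s₀ ∧ ‖((W b : (Matrix (Fin 2) (Fin 2) ℂ)ˣ) : Matrix (Fin 2) (Fin 2) ℂ) - 1‖ ≤ s₁ ∧
          ‖((W b : (Matrix (Fin 2) (Fin 2) ℂ)ˣ) : Matrix (Fin 2) (Fin 2) ℂ) - ((U₀ b : (Matrix (Fin 2) (Fin 2) ℂ)ˣ) : Matrix (Fin 2) (Fin 2) ℂ)‖ ≤ δ) →
      ‖((dbarCovU U₀ W c : (Matrix (Fin 2) (Fin 2) ℂ)ˣ) : Matrix (Fin 2) (Fin 2) ℂ) * (((emlAvgU U₀ c)⁻¹ : (Matrix (Fin 2) (Fin 2) ℂ)ˣ) : Matrix (Fin 2) (Fin 2) ℂ) - 1‖ ≤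
        ((F.P K).L : ℝ) * δ + C₁ * ((((F.P K).d + 2) * (F.P K).L : ℕ) : ℝ) ^ 2 * (s₀ + s₁) ^ 2)
    (hframe : ∀ (j : ℕ), j + 1 ≤ (F.P K).m + (F.P K).K → ∀ (U₀ W : GaugeField (F.P K) j (Matrix (Fin 2) (Fin 2) ℂ)ˣ) (y : Site (F.P K) (j + 1)) (s₀ s₁ δ : ℝ),
      0 ≤ s₀ → 0 ≤ s₁ → 0 ≤ δ → 120 * ((((F.P K).d + 2) * (F.P K).L : ℕ) : ℝ) * (s₀ + s₁) ≤ 1 →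
      (∀ b : PBond (F.P K) j, blockOf b.src = y → blockOf b.tgt = y →
        ‖((U₀ b : (Matrix (Fin 2) (Fin 2) ℂ)ˣ) : Matrix (Fin 2) (Fin 2) ℂ) - 1‖ ≤ s₀ ∧ ‖((W b : (Matrix (Fin 2) (Fin 2) ℂ)ˣ) : Matrix (Fin 2) (Fin 2) ℂ) - 1‖ ≤ s₁ ∧
          ‖((W b : (Matrix (Fin 2) (Fin 2) ℂ)ˣ) : Matrix (Fin 2) (Fin 2) ℂ) - ((U₀ b : (Matrix (Fin 2) (Fin 2) ℂ)ˣ) : Matrix (Fin 2) (Fin 2) ℂ)‖ ≤ δ) →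
      ‖((vframeCovU U₀ W y : (Matrix (Fin 2) (Fin 2) ℂ)ˣ) : Matrix (Fin 2) (Fin 2) ℂ) - 1‖ ≤
        ((((F.P K).d + 2) * (F.P K).L : ℕ) : ℝ) * δ + C₁ * ((((F.P K).d + 2) * (F.P K).L : ℕ) : ℝ) ^ 2 * (s₀ + s₁) ^ 2)
    {ε₀ e : ℝ} (hε₀ : 0 < ε₀) (he : 0 ≤ e) (hε : 10 ^ 7 * (F.L : ℝ) ^ 3 * ε₀ ≤ 1) (he6 : 10 ^ 6 * (F.L : ℝ) ^ 2 * e ≤ 1)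
    (hWF : 8 * (16 * C₁ + 2) * (5 * (F.L : ℝ)) ^ 2 * (2 * e + 2700 * (F.L : ℝ) * ε₀) ≤ 1)
    (U₀ : GaugeField (F.P K) 0 (Matrix.specialUnitaryGroup (Fin 2) ℂ)) (hreg : RegPr F n K ε₀ U₀)
    (A : PBond (F.P K) 0 → Matrix (Fin 2) (Fin 2) ℂ) (hA : ∀ b, ‖A b‖ ≤ e * eta F n K) (c : PBond (F.P n) 0) :
    ‖((dbarTwS F n K h U₀ A c : (Matrix (Fin 2) (Fin 2) ℂ)ˣ) : Matrix (Fin 2) (Fin 2) ℂ) - 1‖ ≤ 3 * (2 * e + 2700 * (F.L : ℝ) * ε₀) ∧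
      ‖((frameTwS F n K h U₀ A c.src : (Matrix (Fin 2) (Fin 2) ℂ)ˣ) : Matrix (Fin 2) (Fin 2) ℂ) - 1‖ ≤ 30 * (F.L : ℝ) * (2 * e + 2700 * (F.L : ℝ) * ε₀) ∧
      ‖((frameTwS F n K h U₀ A c.tgt : (Matrix (Fin 2) (Fin 2) ℂ)ˣ) : Matrix (Fin 2) (Fin 2) ℂ) - 1‖ ≤ 30 * (F.L : ℝ) * (2 * e + 2700 * (F.L : ℝ) * ε₀) := by
  -- letters
  have hd : (F.P K).d = 3 := T3Family.P_d F K
  have hLL : ((F.P K).L : ℝ) = F.L := rfl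
  have hL3 : 3 ≤ F.L := by obtain ⟨a, ha⟩ := F.hL.1; have := F.hL.2; omega
  have hL0 : (0 : ℝ) < F.L := by exact_mod_cast (show 0 < F.L by omega)
  have hk1 : K - n + 1 ≤ (F.P K).m + (F.P K).K := by
    show K - n + 1 ≤ F.m + K; have := F.hm; omega
  have hℓ : ((((F.P K).d + 2) * (F.P K).L : ℕ) : ℝ) = 5 * (F.L : ℝ) := by
    rw [hd, ← hLL]; push_cast; ring
  obtain ⟨hsB0, hxX, hbud₀⟩ := budget_T3_frames F (n := n) (K := K) e hε₀ hε
  set η : ℝ := ((F.L : ℝ)⁻¹) ^ (K - n) with hη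
  have hη0 : 0 < η := by positivity
  have hηne : η ≠ 0 := hη0.ne'
  have hηeta : eta F n K = η := rfl
  -- the plaquette window and the budgets at the T³ letters
  set a₀ : ℝ := regThreshold F n K ε₀ with ha₀
  have ha₀0 : 0 < a₀ := by rw [ha₀]; unfold regThreshold; positivity
  have hXa : (F.L : ℝ) ^ (K - n) * ((F.L : ℝ) ^ (K - n) * a₀) = ε₀ := by
    have hX2 : (F.L : ℝ) ^ (K - n) * (F.L : ℝ) ^ (K - n) = (F.L : ℝ) ^ (2 * (K - n)) := by rw [← pow_add, two_mul]
    have ha : a₀ = ε₀ * ((F.L : ℝ) ^ (2 * (K - n)))⁻¹ := by rw [ha₀]; unfold regThreshold; rw [inv_pow]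
    rw [← mul_assoc, hX2, ha, mul_comm ε₀, ← mul_assoc, mul_inv_cancel₀ (pow_ne_zero _ hL0.ne'), one_mul]
  have hU := hreg.1
  obtain ⟨ht1, -, -, -⟩ := budget_T3 F (K - n) hε₀ hε he he6 ha₀0.le hXa
  have hX00 : 0 ≤ 2 * e + 2700 * (F.L : ℝ) * ε₀ := by positivity
  -- the two budgets of §1
  have hx0 : 0 ≤ ((F.P K).L : ℝ) ^ (K - n) * (2 * (η * e) +
      30 * ((((F.P K).d + 2) * (F.P K).L : ℕ) : ℝ) * (2 * (((F.P K).d : ℝ) * (3 * ((F.P K).L : ℝ) ^ (K - n) - 1)) * a₀)) := by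
    have : 0 ≤ ((((F.P K).d + 2) * (F.P K).L : ℕ) : ℝ) := Nat.cast_nonneg _
    rw [hLL]; positivity
  have hbud : 8 * (16 * C₁ + 2) * ((((F.P K).d + 2) * (F.P K).L : ℕ) : ℝ) ^ 2 *
      (((F.P K).L : ℝ) ^ (K - n) * (2 * (η * e) + 30 * ((((F.P K).d + 2) * (F.P K).L : ℕ) : ℝ) * (2 * (((F.P K).d : ℝ) * (3 * ((F.P K).L : ℝ) ^ (K - n) - 1)) * a₀))) ≤ 1 := by
    have hC : 0 ≤ 8 * (16 * C₁ + 2) * ((((F.P K).d + 2) * (F.P K).L : ℕ) : ℝ) ^ 2 := by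
      have : 0 ≤ ((((F.P K).d + 2) * (F.P K).L : ℕ) : ℝ) := Nat.cast_nonneg _
      have : 0 ≤ 16 * C₁ + 2 := by linarith
      positivity
    refine (mul_le_mul_of_nonneg_left hxX hC).trans ?_
    rw [hℓ]; exact hWF
  -- the reads of the rescaled exponent `A″ = (iη)⁻¹A`: `‖ηA″(b)‖ ≤ ηe`
  have hA' : ∀ b, ‖(η : ℂ) • ((fun b => (Complex.I * (η : ℂ))⁻¹ • A b) b)‖ ≤ η * e := fun b =>
    norm_smul_eta_inv_le F hηne A (fun b => by rw [← hηeta]; exact hA b) b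
  -- §1 at the T³ letters
  obtain ⟨hrel, hws, hwt⟩ := norm_dbarCovIterU_rel_frameAccU_le_of_plaqSmall (P := F.P K) hC₁ hstep hframe hk1 U₀ ha₀0 hU η
    (fun b => (Complex.I * (η : ℂ))⁻¹ • A b) ht1 hA' hbud₀ hbud (bondShift (sites_eq F n K h) c)
  -- the dictionary: the perturbed field, the background, (92)
  have hW : (fun b => expUnit (A b) * bgUnits F K U₀ b) = fun b => expCfg η (fun b => (Complex.I * (η : ℂ))⁻¹ • A b) b * unitsField (toUField U₀) b :=
    perturbedField_eq F K hηne U₀ A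
  have hxX' : 3 * (((F.P K).L : ℝ) ^ (K - n) * (2 * (η * e) +
      30 * ((((F.P K).d + 2) * (F.P K).L : ℕ) : ℝ) * (2 * (((F.P K).d : ℝ) * (3 * ((F.P K).L : ℝ) ^ (K - n) - 1)) * a₀))) ≤ 3 * (2 * e + 2700 * (F.L : ℝ) * ε₀) := by
    linarith
  have hxX'' : 6 * ((((F.P K).d + 2) * (F.P K).L : ℕ) : ℝ) * (((F.P K).L : ℝ) ^ (K - n) * (2 * (η * e) +
      30 * ((((F.P K).d + 2) * (F.P K).L : ℕ) : ℝ) * (2 * (((F.P K).d : ℝ) * (3 * ((F.P K).L : ℝ) ^ (K - n) - 1)) * a₀))) ≤ 30 * (F.L : ℝ) * (2 * e + 2700 * (F.L : ℝ) * ε₀) := by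
    have h1 := mul_le_mul_of_nonneg_left hxX (by positivity : (0 : ℝ) ≤ 6 * ((((F.P K).d + 2) * (F.P K).L : ℕ) : ℝ))
    have h2 : 6 * ((((F.P K).d + 2) * (F.P K).L : ℕ) : ℝ) * (2 * e + 2700 * (F.L : ℝ) * ε₀) = 30 * (F.L : ℝ) * (2 * e + 2700 * (F.L : ℝ) * ε₀) := by
      rw [hℓ]; ring
    linarith
  refine ⟨?_, ?_, ?_⟩
  · rw [dbarTwS_eq_dbarCovIterU_mul_inv, hW, bgUnits_eq, Units.val_mul]
    exact hrel.trans hxX'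
  · rw [frameTwS_def, hW, bgUnits_eq, ← bondShift_src]
    exact hws.trans hxX''
  · have ht : PBond.tgt (P := F.P K) (bondShift (sites_eq F n K h) c) = siteShift (sites_eq F n K h) c.tgt := bondShift_tgt _ _
    rw [ht] at hwt
    rw [frameTwS_def, hW, bgUnits_eq]
    exact hwt.trans hxX''

end T3

end Summit.QuantumFields.YangMills.Theorems.Prop7DbarTwSymWindow

namespace Summit.QuantumFields.YangMills.Theorems.Prop7DbarTwSymWindow

/-! ## §3 ★★★ (WIN-twˢ): the one-step rows DISCHARGED by W1 (`C₁ = 22100`), the window in L-only numerals -/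

section Window

open scoped Matrix.Norms.L2Operator
open Literature.MathematicalPhysics.QuantumFieldTheory.Balaban1983to89
open Literature.MathematicalPhysics.QuantumFieldTheory.Balaban1983to89.T3ContinuumYM3Torus
open T3PrintedRegularMinimiser (RegPr)
open T3SectALandauChart (eta eta_pos)
open Summit.QuantumFields.YangMills.Theorems.Prop8Chart (emlAvgU)
open Summit.QuantumFields.YangMills.Theorems.Prop7TPrint (nMax19)
open Summit.QuantumFields.YangMills.Theorems.Prop7SymAvgTwSym (vframeCovU dbarCovU frameTwS dbarTwS norm_dbarCovU_mul_inv_sub_one_le norm_vframeCovU_sub_one_le_of_diff)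
open Summit.QuantumFields.YangMills.Theorems.Prop7DbarTwWindow (norm_smul_I_le_of_nMax19_lt)

variable (F : T3Family) {n K : ℕ} (h : n ≤ K)

/-- W1's relative one step in the conjunction-read shape of W2∕§1 (`C₁ = 22100`; ★w4-19200 g3's ✓`Prop7SymAvgTwSym.norm_dbarCovU_mul_inv_sub_one_le`). [cite: Balaban1985Averaging, (89) p.31, (123)–(125) p.36] -/
theorem hstep_T3 : ∀ (j : ℕ), j + 1 ≤ (F.P K).m + (F.P K).K → ∀ (U₀ W : GaugeField (F.P K) j (Matrix (Fin 2) (Fin 2) ℂ)ˣ) (c : PBond (F.P K) (j + 1)) (s₀ s₁ δ : ℝ),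
      0 ≤ s₀ → 0 ≤ s₁ → 0 ≤ δ → 120 * ((((F.P K).d + 2) * (F.P K).L : ℕ) : ℝ) * (s₀ + s₁) ≤ 1 →
      (∀ b : PBond (F.P K) j, (blockOf b.src = c.src ∨ blockOf b.src = c.tgt) → (blockOf b.tgt = c.src ∨ blockOf b.tgt = c.tgt) →
        ‖((U₀ b : (Matrix (Fin 2) (Fin 2) ℂ)ˣ) : Matrix (Fin 2) (Fin 2) ℂ) - 1‖ ≤ s₀ ∧ ‖((W b : (Matrix (Fin 2) (Fin 2) ℂ)ˣ) : Matrix (Fin 2) (Fin 2) ℂ) - 1‖ ≤ s₁ ∧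
          ‖((W b : (Matrix (Fin 2) (Fin 2) ℂ)ˣ) : Matrix (Fin 2) (Fin 2) ℂ) - ((U₀ b : (Matrix (Fin 2) (Fin 2) ℂ)ˣ) : Matrix (Fin 2) (Fin 2) ℂ)‖ ≤ δ) →
      ‖((dbarCovU U₀ W c : (Matrix (Fin 2) (Fin 2) ℂ)ˣ) : Matrix (Fin 2) (Fin 2) ℂ) * (((emlAvgU U₀ c)⁻¹ : (Matrix (Fin 2) (Fin 2) ℂ)ˣ) : Matrix (Fin 2) (Fin 2) ℂ) - 1‖ ≤
        ((F.P K).L : ℝ) * δ + 22100 * ((((F.P K).d + 2) * (F.P K).L : ℕ) : ℝ) ^ 2 * (s₀ + s₁) ^ 2 :=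
  by
  intro j hj U₀ W c s₀ s₁ δ hs₀ hs₁ hδ hℓ hr
  exact norm_dbarCovU_mul_inv_sub_one_le hj c hs₀ hs₁ hδ hℓ (fun b hs ht => (hr b hs ht).1) (fun b hs ht => (hr b hs ht).2.1) (fun b hs ht => (hr b hs ht).2.2)

/-- W1's one-level covariant frame in the conjunction-read shape, constant weakened `3000 ≤ 22100` (✓`Prop7SymAvgTwSym.norm_vframeCovU_sub_one_le_of_diff`). [cite: Balaban1985Averaging, (82) p.30, (163) p.42] -/
theorem hframe_T3 : ∀ (j : ℕ), j + 1 ≤ (F.P K).m + (F.P K).K → ∀ (U₀ W : GaugeField (F.P K) j (Matrix (Fin 2) (Fin 2) ℂ)ˣ) (y : Site (F.P K) (j + 1)) (s₀ s₁ δ : ℝ),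
      0 ≤ s₀ → 0 ≤ s₁ → 0 ≤ δ → 120 * ((((F.P K).d + 2) * (F.P K).L : ℕ) : ℝ) * (s₀ + s₁) ≤ 1 →
      (∀ b : PBond (F.P K) j, blockOf b.src = y → blockOf b.tgt = y →
        ‖((U₀ b : (Matrix (Fin 2) (Fin 2) ℂ)ˣ) : Matrix (Fin 2) (Fin 2) ℂ) - 1‖ ≤ s₀ ∧ ‖((W b : (Matrix (Fin 2) (Fin 2) ℂ)ˣ) : Matrix (Fin 2) (Fin 2) ℂ) - 1‖ ≤ s₁ ∧
          ‖((W b : (Matrix (Fin 2) (Fin 2) ℂ)ˣ) : Matrix (Fin 2) (Fin 2) ℂ) - ((U₀ b : (Matrix (Fin 2) (Fin 2) ℂ)ˣ) : Matrix (Fin 2) (Fin 2) ℂ)‖ ≤ δ) →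
      ‖((vframeCovU U₀ W y : (Matrix (Fin 2) (Fin 2) ℂ)ˣ) : Matrix (Fin 2) (Fin 2) ℂ) - 1‖ ≤
        ((((F.P K).d + 2) * (F.P K).L : ℕ) : ℝ) * δ + 22100 * ((((F.P K).d + 2) * (F.P K).L : ℕ) : ℝ) ^ 2 * (s₀ + s₁) ^ 2 := by
  intro j hj U₀ W y s₀ s₁ δ hs₀ hs₁ hδ hℓ hr
  have h1 := norm_vframeCovU_sub_one_le_of_diff hj y hs₀ hs₁ hδ hℓ (fun b hs ht => (hr b hs ht).1) (fun b hs ht => (hr b hs ht).2.1) (fun b hs ht => (hr b hs ht).2.2)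
  refine h1.trans ?_
  have h0 : 0 ≤ ((((F.P K).d + 2) * (F.P K).L : ℕ) : ℝ) ^ 2 * (s₀ + s₁) ^ 2 := by positivity
  nlinarith

/-- **THE NUMERALS**: `10⁹L²e ≤ 1` and `10¹²L³ε₀ ≤ 1` imply the frame window (WF) at `C₁ = 22100` (`8·353602·25·L²·(2e + 2700Lε₀) ≤ 0.142 + 0.191`) and the two numerals of
✓`Prop7DbarTwWindow` (`10⁶L²e ≤ 1`, `10⁷L³ε₀ ≤ 1`). [cite: Balaban1985Variational, (2) p.278, (19) p.281] -/
theorem windows_of_numerals {ε₀ e : ℝ} (hε₀ : 0 ≤ ε₀) (he : 0 ≤ e) (hWe : 10 ^ 9 * (F.L : ℝ) ^ 2 * e ≤ 1) (hWε : 10 ^ 12 * (F.L : ℝ) ^ 3 * ε₀ ≤ 1) :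
    8 * (16 * (22100 : ℝ) + 2) * (5 * (F.L : ℝ)) ^ 2 * (2 * e + 2700 * (F.L : ℝ) * ε₀) ≤ 1 ∧ 10 ^ 7 * (F.L : ℝ) ^ 3 * ε₀ ≤ 1 ∧ 10 ^ 6 * (F.L : ℝ) ^ 2 * e ≤ 1 := by
  have h2 : 0 ≤ (F.L : ℝ) ^ 2 * e := by positivity
  have h3 : 0 ≤ (F.L : ℝ) ^ 3 * ε₀ := by positivity
  refine ⟨?_, by nlinarith, by nlinarith⟩
  have e1 : 8 * (16 * (22100 : ℝ) + 2) * (5 * (F.L : ℝ)) ^ 2 * (2 * e + 2700 * (F.L : ℝ) * ε₀)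
      = 141440800 * ((F.L : ℝ) ^ 2 * e) + 190945080000 * ((F.L : ℝ) ^ 3 * ε₀) := by ring
  rw [e1]; nlinarith

/-- ★★ **`‖U̿^{twS}(A)(c) − 1‖ ≤ 3(2e + 2700Lε₀)` AT A PRINTED-REGULAR BACKGROUND, ROWS DISCHARGED**: for `U₀ ∈ 𝔘_k(ε₀)` and every complex bondwise `A` with `‖A(b)‖ ≤ e·η`, under the
L-only numerals `10⁹L²e ≤ 1`, `10¹²L³ε₀ ≤ 1` (§2 ∘ W1's `C₁ = 22100`); and the accumulated symmetric frames at the two ends of `c` are within `30L(2e + 2700Lε₀)` of `1`.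
[cite: Balaban1985Averaging, (92) p.31, (161)–(163) p.42, p.44; Balaban1985RegularSpaces, (1.31) p.82; Balaban1985Variational, (2) p.278, (44) p.285] -/
theorem norm_dbarTwS_sub_one_le {ε₀ e : ℝ} (hε₀ : 0 < ε₀) (he : 0 ≤ e) (hWe : 10 ^ 9 * (F.L : ℝ) ^ 2 * e ≤ 1) (hWε : 10 ^ 12 * (F.L : ℝ) ^ 3 * ε₀ ≤ 1)
    (U₀ : GaugeField (F.P K) 0 (Matrix.specialUnitaryGroup (Fin 2) ℂ)) (hreg : RegPr F n K ε₀ U₀)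
    (A : PBond (F.P K) 0 → Matrix (Fin 2) (Fin 2) ℂ) (hA : ∀ b, ‖A b‖ ≤ e * eta F n K) (c : PBond (F.P n) 0) :
    ‖((dbarTwS F n K h U₀ A c : (Matrix (Fin 2) (Fin 2) ℂ)ˣ) : Matrix (Fin 2) (Fin 2) ℂ) - 1‖ ≤ 3 * (2 * e + 2700 * (F.L : ℝ) * ε₀) ∧
      ‖((frameTwS F n K h U₀ A c.src : (Matrix (Fin 2) (Fin 2) ℂ)ˣ) : Matrix (Fin 2) (Fin 2) ℂ) - 1‖ ≤ 30 * (F.L : ℝ) * (2 * e + 2700 * (F.L : ℝ) * ε₀) ∧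
      ‖((frameTwS F n K h U₀ A c.tgt : (Matrix (Fin 2) (Fin 2) ℂ)ˣ) : Matrix (Fin 2) (Fin 2) ℂ) - 1‖ ≤ 30 * (F.L : ℝ) * (2 * e + 2700 * (F.L : ℝ) * ε₀) := by
  obtain ⟨hWF, hε, he6⟩ := windows_of_numerals F hε₀.le he hWe hWε
  exact norm_dbarTwS_sub_one_le_of_regPr F h (by norm_num) (hstep_T3 F) (hframe_T3 F) hε₀ he hε he6 hWF U₀ hreg A hA c

/-- ★★★ **(WIN-twˢ) — THE `log` WINDOW OF THE RE-BASED TWISTED AVERAGE AT CHART POINTS, DISCHARGED FROM `RegPr`** (the symmetric-frame twin of ✓p609764 `dbarTw_window_of_regPr`,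
OWNER RULING g26-№12 (3d)∕№13 (iii) W3): for `U₀ ∈ 𝔘_k(ε₀)`, `10⁹L²e ≤ 1`, `10¹²L³ε₀ ≤ 1`, every bondwise `X` of (19)-size `nMax19 F n K U₀ X < e` and every comparison bond `c`:
`‖↑(dbarTwS F n K h U₀ (fun b => Complex.I • X b) c) − 1‖ ≤ ½ < 1` (`3(2e + 2700Lε₀) ≤ 6·10⁻⁹ + 8.1·10⁻⁹`).  No (WΣ) window; the Hermitian-traceless hypothesis of the knit's
binder is not needed. [cite: Balaban1985RegularSpaces, (1.31) p.82, Prop. 7 p.100; Balaban1985Averaging, (89)–(92) p.31, (161)–(163) p.42, p.44; Balaban1985Variational, (19) p.281, (44) p.285] -/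
theorem dbarTwS_window_of_regPr {ε₀ e : ℝ} (hε₀ : 0 < ε₀) (he : 0 < e) (hWe : 10 ^ 9 * (F.L : ℝ) ^ 2 * e ≤ 1) (hWε : 10 ^ 12 * (F.L : ℝ) ^ 3 * ε₀ ≤ 1)
    (U₀ : GaugeField (F.P K) 0 (Matrix.specialUnitaryGroup (Fin 2) ℂ)) (hreg : RegPr F n K ε₀ U₀)
    (X : PBond (F.P K) 0 → Matrix (Fin 2) (Fin 2) ℂ) (hX : nMax19 F n K U₀ X < e) (c : PBond (F.P n) 0) :
    ‖((dbarTwS F n K h U₀ (fun b => Complex.I • X b) c : (Matrix (Fin 2) (Fin 2) ℂ)ˣ) : Matrix (Fin 2) (Fin 2) ℂ) - 1‖ ≤ 1 / 2 ∧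
      ‖((dbarTwS F n K h U₀ (fun b => Complex.I • X b) c : (Matrix (Fin 2) (Fin 2) ℂ)ˣ) : Matrix (Fin 2) (Fin 2) ℂ) - 1‖ < 1 := by
  have h1 := (norm_dbarTwS_sub_one_le F h hε₀ he.le hWe hWε U₀ hreg (fun b => Complex.I • X b) (norm_smul_I_le_of_nMax19_lt F hX) c).1
  have hL3 : 3 ≤ F.L := by obtain ⟨a, ha⟩ := F.hL.1; have := F.hL.2; omega
  have hL3r : (3 : ℝ) ≤ F.L := by exact_mod_cast hL3
  have h9 : (9 : ℝ) ≤ (F.L : ℝ) ^ 2 := by nlinarith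
  have h27 : (27 : ℝ) ≤ (F.L : ℝ) ^ 3 := by nlinarith
  have hsmall : 3 * (2 * e + 2700 * (F.L : ℝ) * ε₀) ≤ 1 / 2 := by
    have hL13 : (F.L : ℝ) ≤ (F.L : ℝ) ^ 3 := by nlinarith
    have ha : (F.L : ℝ) * ε₀ ≤ (F.L : ℝ) ^ 3 * ε₀ := mul_le_mul_of_nonneg_right hL13 hε₀.le
    nlinarith [mul_nonneg (by norm_num : (0:ℝ) ≤ 9) he.le]
  exact ⟨h1.trans hsmall, (h1.trans hsmall).trans_lt (by norm_num)⟩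

end Window

end Summit.QuantumFields.YangMills.Theorems.Prop7DbarTwSymWindow

end
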